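import Mathlib
import HarnessLib
import HarnessLib.Audit
import Summits.AtomisticToContinuum.Crystallization.Statement
import Summits.AtomisticToContinuum.Crystallization.Theses.BrittleRungDescent
import Summits.AtomisticToContinuum.Crystallization.Theses.LaminarSixThreeThree
import Summits.AtomisticToContinuum.Crystallization.Theses.HullMinimality
import Summits.AtomisticToContinuum.Crystallization.Theses.PhononSlackCertificates
import Summits.AtomisticToContinuum.Crystallization.Theses.ReggeStarCoercivity
import Summits.AtomisticToContinuum.Crystallization.Theorems.HullMinimalityHullCriterionConverse
import Summits.AtomisticToContinuum.Crystallization.Theorems.PhononSlackCertificatesWindowOptimality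
import Summits.AtomisticToContinuum.Crystallization.Theorems.PhononSlackCertificatesNearFarGlueRRouteNeeds
import Literature.Geometry.DiscreteGeometry.TwoShellPatterns
import Literature.MathematicalPhysics.StatisticalMechanics.LennardJonesClusters

/-!
# Crux `LJBarlowRigidity` (stmt-AtomisticToContinuum-9206) — line `defect-free-transfer` (strategist, ALTERNATIVE to `birth`; lens: TRANSFER)

Transfer at crux level to the sibling crux `ReggeStarCoercivity.DefectFreeCrystallizes` (stmt-13603, rank 5 of
route `ReggeStarCoercivity`, active lead c8, line `palm-good-law`): that crux says `ZeroDefectDensity →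
IsCrystallizing lennardJones 3`, where `ZeroDefectDensity` = "a.e. particle has a `1/20`-good FIRST shell
(radius `6/5`, rescaled by some `a ∈ [9/10, 11/10]`, `ShellCloseTo (1/20)` the fcc or hcp kissing pattern)".
Our hypothesis `H` (a.e. `4a`-balls of `1/400`-kissed particles with fcc/hcp CONTACT GRAPHS) is STRONGER, up to
two cheap statements: a scale window (so that the absolute `6/5`-shell is exactly the twelve soft neighbours:
`63a/50 > 6/5 > a(1 + 1/400)`) and the metric reading of an exact contact graph at tolerance `1/400`
(`ShellCloseTo (1/20)`).  And `IsCrystallizing lennardJones 3 → Crystallization` is LANDED glue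
(`crystallization_of_isCrystallizing` below: converse hull criterion 11780 + `windowOptimality_proof` 13962 +
`CrysEnergyLimit_holds` + existence), so the energetic conjunct of the crux costs nothing.

Stubs: `stub_scaleWindow13603` (B1, M–L, energy pinning as in line `soft-truss-fractions` with the window
`[953/1000, 11/10]`), `stub_shellCloseOfTrussGraph` (B2, M, pure geometry), `stub_defectFreeCrystallizes`
(B3 = item 13603 BY NAME, XL, shared).  Composition `LJBarlowRigidity_of` PROVED: `H`-bad ⊇ `13603`-bad
(counting glue) gives `ZeroDefectDensity` for every ground-state sequence, 13603 gives `IsCrystallizing`, the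
landed glue gives `Crystallization`.  What replaces the structure 13603 lacks: nothing is lacking — 13603's
hypothesis is WEAKER than `H`; the transfer says the LJ end of `BrittleRungDescent` is dominated by 13603, and
(see line `soft-truss-fractions`) that under `H`'s `1/400` tolerance 13603's own residue (S4′ funnel rigidity on
the 5 % funnel) drops to the harmonic regime.

`sorry` only inside the three `stub_*`.  Disproof used: none on file for 9206; 13603's `Disproof.lean` (v14)
`not_defectFreeCrystallizesWithoutGroundStates` (the crux is false with `IsGroundState` replaced by injective +
separated) is honoured: B1 and the consumer B3 quantify over genuine ground states.
-/

namespace Summit.AtomisticToContinuum.Crystallization.Cruxes.LJBarlowRigidity.DefectFreeTransfer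

open Filter
open scoped Classical

/-! ## Landed glue (proved): the sub-problem is its positional conjunct -/

/-- **`IsCrystallizing lennardJones 3 → Crystallization`**, all from LANDED theorems: the converse hull
criterion (`hullCriterionConverse_proof`, item 11780) gives periodic windows of every ground-state
sequence; `windowOptimality_proof` (item 13962) makes their `P` a least element of the periodic energy
per particle; `CrysEnergyLimit_holds` (item 0626) and `LennardJonesGroundStatesExist_holds` turn that
into `HasPeriodicGroundStateEnergy`. [folklore] -/
theorem crystallization_of_isCrystallizing
    (h : Literature.MathematicalPhysics.StatisticalMechanics.IsCrystallizing Literature.MathematicalPhysics.StatisticalMechanics.lennardJones 3) : _root_.Crystallization := by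
  have hPW : Summit.AtomisticToContinuum.Crystallization.Theses.HullMinimality.PeriodicWindows :=
    Summit.AtomisticToContinuum.Crystallization.Theorems.hullCriterionConverse_proof h
  have hWO := Summit.AtomisticToContinuum.Crystallization.Theorems.windowOptimality_proof
  unfold Summit.AtomisticToContinuum.Crystallization.Theses.PhononSlackCertificates.WindowOptimality
    at hWO
  obtain ⟨x, hx⟩ : ∃ x : (N : ℕ) → (Fin N → EuclideanSpace ℝ (Fin 3)), ∀ N, Literature.MathematicalPhysics.StatisticalMechanics.IsGroundState Literature.MathematicalPhysics.StatisticalMechanics.lennardJones (x N) :=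
    ⟨fun N => (Literature.MathematicalPhysics.StatisticalMechanics.LennardJonesGroundStatesExist_holds N).choose,
      fun N => (Literature.MathematicalPhysics.StatisticalMechanics.LennardJonesGroundStatesExist_holds N).choose_spec⟩
  obtain ⟨P, hP⟩ := hPW x hx
  have hleast : IsLeast (Set.range fun Q : Literature.MathematicalPhysics.StatisticalMechanics.PeriodicConfiguration 3 =>
      Q.energyPerParticle Literature.MathematicalPhysics.StatisticalMechanics.lennardJones) (P.energyPerParticle Literature.MathematicalPhysics.StatisticalMechanics.lennardJones) :=
    hWO x hx P hP
  have hinf : (⨅ Q : Literature.MathematicalPhysics.StatisticalMechanics.PeriodicConfiguration 3, Q.energyPerParticle Literature.MathematicalPhysics.StatisticalMechanics.lennardJones) =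
      P.energyPerParticle Literature.MathematicalPhysics.StatisticalMechanics.lennardJones := hleast.csInf_eq
  have h0 := Summit.AtomisticToContinuum.Crystallization.Theses.LaminarSixThreeThree.CrysEnergyLimit_holds
  unfold Summit.AtomisticToContinuum.Crystallization.Theses.LaminarSixThreeThree.CrysEnergyLimit at h0
  rw [hinf] at h0
  exact ⟨⟨P, hleast, h0⟩, h⟩

/-- Hence the crux is EQUIVALENT to `H → IsCrystallizing lennardJones 3`. [folklore] -/
theorem crux_iff_positional : Summit.AtomisticToContinuum.Crystallization.Theses.BrittleRungDescent.LJBarlowRigidity ↔ ((∃ a : ℝ, 0 < a ∧ ∀ x : (N : ℕ) → (Fin N → EuclideanSpace ℝ (Fin 3)), (∀ N, Literature.MathematicalPhysics.StatisticalMechanics.IsGroundState Literature.MathematicalPhysics.StatisticalMechanics.lennardJones (x N)) → Filter.Tendsto (fun N : ℕ => (Nat.card {i : Fin N // ¬ ∀ j : Fin N, dist (x N i) (x N j) ≤ 4 * a → (((∀ l : Fin N, l ≠ j → a * (1 - 1 / 400) ≤ dist (x N j) (x N l) ∧ (dist (x N j) (x N l) ≤ a * (1 + 1 / 400) ∨ 63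 / 50 * a ≤ dist (x N j) (x N l))) ∧ Nat.card {l : Fin N // l ≠ j ∧ dist (x N j) (x N l) ≤ a * (1 + 1 / 400)} = 12) ∧ ((∃ e : {k : Fin N // k ≠ j ∧ dist (x N j) (x N k) ≤ a * (1 + 1 / 400)} ≃ {q : EuclideanSpace ℝ (Fin 3) // q ∈ Literature.Geometry.DiscreteGeometry.fccKissingPattern}, ∀ k k' : {k : Fin N // k ≠ j ∧ dist (x N j) (x N k) ≤ a * (1 + 1 / 400)}, k ≠ k' → (dist (x N k.1) (x N k'.1) ≤ a * (1 + 1 / 400) ↔ dist (e k).1 (e k').1 = 1)) ∨ (∃ e : {k : Fin N // k ≠ j ∧ dist (x N j) (x N k) ≤ a * (1 + 1 / 400)} ≃ {q : EuclideanSpace ℝ (Fin 3) // q ∈ Literature.Geometry.DiscreteGeometry.hcpKissingPattern}, ∀ k k' : {k : Fin N // k ≠ j ∧ dist (x N j) (x N k) ≤ a * (1 + 1 / 400)}, k ≠ k' → (dist (x N k.1) (x N k'.1) ≤ a * (1 + 1 / 400) ↔ dist (e k).1 (e k').1 = 1))))} : ℝ) / N) Filter.atTop (nhds 0)) → Literature.MathematicalPhysics.StatisticalMechanics.IsCrystallizing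 Literature.MathematicalPhysics.StatisticalMechanics.lennardJones 3) :=
  ⟨fun h hH => (h hH).2, fun h hH => crystallization_of_isCrystallizing (h hH)⟩

/-- Counting glue: a pointwise implication of predicates on `Fin N` gives the comparison of the
`Nat.card`s of the complementary subtypes. [folklore] -/
theorem natCard_not_mono {N : ℕ} {B G : Fin N → Prop} (h : ∀ i, B i → G i) :
    Nat.card {i : Fin N // ¬ G i} ≤ Nat.card {i : Fin N // ¬ B i} :=
  Nat.card_le_card_of_injective
    (fun p : {i : Fin N // ¬ G i} => (⟨p.1, fun hB => p.2 (h p.1 hB)⟩ : {i : Fin N // ¬ B i}))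
    (by
      intro p q hpq
      simp only [Subtype.mk.injEq] at hpq
      exact Subtype.ext hpq)

/-- Density glue: if the `B`-bad density tends to `0` and `B ⇒ G` pointwise, the `G`-bad density
tends to `0`. [folklore] -/
theorem tendsto_density_mono (B G : (N : ℕ) → Fin N → Prop) (h : ∀ N i, B N i → G N i)
    (hB : Filter.Tendsto (fun N : ℕ => (Nat.card {i : Fin N // ¬ B N i} : ℝ) / N) Filter.atTop (nhds 0)) :
    Filter.Tendsto (fun N : ℕ => (Nat.card {i : Fin N // ¬ G N i} : ℝ) / N) Filter.atTop (nhds 0) := by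
  refine squeeze_zero (fun N => by positivity) (fun N => ?_) hB
  gcongr
  exact_mod_cast natCard_not_mono (h N)

/-! ## The stubs -/

/-- **B1 — scale pinning for the transfer window.**  If `H` holds at scale `a` along all LJ ground-state
sequences then `953/1000 ≤ a ≤ 11/10` (so `63a/50 > 6/5 > a(1 + 1/400)`: the absolute `6/5`-shell of a soft-truss
vertex is exactly its twelve soft neighbours, and `a ∈ [9/10, 11/10]`).  Same mechanism as A1 of line
`soft-truss-fractions` (certified `e_Barlow(0.953) − e(hcp*) ≈ 0.010` vs slack `0.003`; upper edge trivial).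
Size M–L. -/
theorem stub_scaleWindow13603 : ∀ a : ℝ, 0 < a → (∀ x : (N : ℕ) → (Fin N → EuclideanSpace ℝ (Fin 3)), (∀ N, Literature.MathematicalPhysics.StatisticalMechanics.IsGroundState Literature.MathematicalPhysics.StatisticalMechanics.lennardJones (x N)) → Filter.Tendsto (fun N : ℕ => (Nat.card {i : Fin N // ¬ ∀ j : Fin N, dist (x N i) (x N j) ≤ 4 * a → (((∀ l : Fin N, l ≠ j → a * (1 - 1 / 400) ≤ dist (x N j) (x N l) ∧ (dist (x N j) (x N l) ≤ a * (1 + 1 / 400) ∨ 63 / 50 * a ≤ dist (x N j) (x N l))) ∧ Nat.card {l : Fin N // l ≠ j ∧ dist (x N j) (x N l) ≤ a * (1 + 1 / 400)} = 12) ∧ ((∃ e : {k : Fin N // k ≠ j ∧ dist (x N j) (x N k) ≤ a * (1 + 1 / 400)} ≃ {q : EuclideanSpace ℝ (Fin 3) // q ∈ Literature.Geometry.DiscreteGeometry.fccKissingPattern}, ∀ k k' : {k : Fin N // k ≠ j ∧ dist (x N j) (x N k) ≤ a * (1 + 1 / 400)}, k ≠ k' → (dist (x N k.1) (x N k'.1)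 ≤ a * (1 + 1 / 400) ↔ dist (e k).1 (e k').1 = 1)) ∨ (∃ e : {k : Fin N // k ≠ j ∧ dist (x N j) (x N k) ≤ a * (1 + 1 / 400)} ≃ {q : EuclideanSpace ℝ (Fin 3) // q ∈ Literature.Geometry.DiscreteGeometry.hcpKissingPattern}, ∀ k k' : {k : Fin N // k ≠ j ∧ dist (x N j) (x N k) ≤ a * (1 + 1 / 400)}, k ≠ k' → (dist (x N k.1) (x N k'.1) ≤ a * (1 + 1 / 400) ↔ dist (e k).1 (e k').1 = 1))))} : ℝ) / N) Filter.atTop (nhds 0)) → 953 / 1000 ≤ a ∧ a ≤ 11 / 10 := by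
  sorry

/-- **B2 — metric reading of an exact soft contact graph (pure geometry).**  If `953/1000 ≤ a ≤ 11/10` and every
particle within `4a` of `x i` is softly twelve-kissed at scale `a` (tolerance `1/400`, gap `63a/50`) with an fcc-
or hcp-pattern soft contact graph, then the `6/5`-shell of `x i`, recentred and rescaled by `a⁻¹`, is
`ShellCloseTo (1/20)` the fcc or the hcp kissing pattern (witness scale `a ∈ [9/10, 11/10]`).  Why plausibly true:
the shell IS the twelve soft neighbours (window); the octet cells around `i` exist combinatorially and are
near-regular (edges `a(1 ± 1/400)`), so after a rotation the twelve rescaled neighbours are within `C/400 ≤ 1/20`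
of the pattern realising the given graph.  Size M.  Leans on: `KissingPatterns` (`ShellCloseTo`, `EtaMatched`),
`KissingRigidity`. -/
theorem stub_shellCloseOfTrussGraph : ∀ a : ℝ, 953 / 1000 ≤ a → a ≤ 11 / 10 → ∀ (N : ℕ) (x : Fin N → EuclideanSpace ℝ (Fin 3)) (i : Fin N), Function.Injective x → (∀ j : Fin N, dist (x i) (x j) ≤ 4 * a → (((∀ l : Fin N, l ≠ j → a * (1 - 1 / 400) ≤ dist (x j) (x l) ∧ (dist (x j) (x l) ≤ a * (1 + 1 / 400) ∨ 63 / 50 * a ≤ dist (x j) (x l))) ∧ Nat.card {l : Fin N // l ≠ j ∧ dist (x j) (x l) ≤ a * (1 + 1 / 400)} = 12) ∧ ((∃ e : {k : Fin N // k ≠ j ∧ dist (x j) (x k) ≤ a * (1 + 1 / 400)} ≃ {q : EuclideanSpace ℝ (Fin 3) // q ∈ Literature.Geometry.DiscreteGeometry.fccKissingPattern}, ∀ k k' : {k : Fin N // k ≠ j ∧ dist (x j) (x k) ≤ a * (1 + 1 / 400)}, k ≠ k' → (dist (x k.1) (x k'.1) ≤ a * (1 + 1 / 400) ↔ dist (e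 k).1 (e k').1 = 1)) ∨ (∃ e : {k : Fin N // k ≠ j ∧ dist (x j) (x k) ≤ a * (1 + 1 / 400)} ≃ {q : EuclideanSpace ℝ (Fin 3) // q ∈ Literature.Geometry.DiscreteGeometry.hcpKissingPattern}, ∀ k k' : {k : Fin N // k ≠ j ∧ dist (x j) (x k) ≤ a * (1 + 1 / 400)}, k ≠ k' → (dist (x k.1) (x k'.1) ≤ a * (1 + 1 / 400) ↔ dist (e k).1 (e k').1 = 1))))) → ∃ a : ℝ, 9 / 10 ≤ a ∧ a ≤ 11 / 10 ∧ (Literature.Geometry.DiscreteGeometry.ShellCloseTo (1 / 20) ((Finset.univ.filter fun j : Fin N => j ≠ i ∧ dist (x i) (x j) ≤ 6 / 5).image fun j => a⁻¹ • (x j - x i)) Literature.Geometry.DiscreteGeometry.fccKissingPattern ∨ Literature.Geometry.DiscreteGeometry.ShellCloseTo (1 / 20) ((Finset.univ.filter fun j : Fin N => j ≠ i ∧ dist (x i) (x j) ≤ 6 / 5).image fun j => a⁻¹ • (x j - x i)) Literature.Geometry.DiscreteGeometry.hcpKissingPattern) := by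
  sorry

/-- **B3 — the sibling crux BY NAME** (item stmt-AtomisticToContinuum-13603, `ReggeStarCoercivity.DefectFreeCrystallizes`,
rank 5, XL, lead c8 on line `palm-good-law`; closed in the tree modulo its S4′ `stub_funnelRigidityRoot` and crux
9226 `LayeredLawsSelectHcp`). -/
theorem stub_defectFreeCrystallizes : Summit.AtomisticToContinuum.Crystallization.Theses.ReggeStarCoercivity.DefectFreeCrystallizes := by
  sorry

/-! ## The composition (kernel-checked, no sorry) -/

/-- **The crux BY NAME from the three stub signatures.** -/
theorem LJBarlowRigidity_of : (∀ a : ℝ, 0 < a → (∀ x : (N : ℕ) → (Fin N → EuclideanSpace ℝ (Fin 3)), (∀ N, Literature.MathematicalPhysics.StatisticalMechanics.IsGroundState Literature.MathematicalPhysics.StatisticalMechanics.lennardJones (x N)) → Filter.Tendsto (fun N : ℕ => (Nat.card {i : Fin N // ¬ ∀ j : Fin N, dist (x N i) (x N j) ≤ 4 * a → (((∀ l : Fin N, l ≠ j → a * (1 - 1 / 400) ≤ dist (x N j) (x N l) ∧ (dist (x N j) (x N l) ≤ a * (1 + 1 / 400) ∨ 63 / 50 * a ≤ dist (x N j) (x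 N l))) ∧ Nat.card {l : Fin N // l ≠ j ∧ dist (x N j) (x N l) ≤ a * (1 + 1 / 400)} = 12) ∧ ((∃ e : {k : Fin N // k ≠ j ∧ dist (x N j) (x N k) ≤ a * (1 + 1 / 400)} ≃ {q : EuclideanSpace ℝ (Fin 3) // q ∈ Literature.Geometry.DiscreteGeometry.fccKissingPattern}, ∀ k k' : {k : Fin N // k ≠ j ∧ dist (x N j) (x N k) ≤ a * (1 + 1 / 400)}, k ≠ k' → (dist (x N k.1) (x N k'.1) ≤ a * (1 + 1 / 400) ↔ dist (e k).1 (e k').1 = 1)) ∨ (∃ e : {k : Fin N // k ≠ j ∧ dist (x N j) (x N k) ≤ a * (1 + 1 / 400)} ≃ {q : EuclideanSpace ℝ (Fin 3) // q ∈ Literature.Geometry.DiscreteGeometry.hcpKissingPattern}, ∀ k k' : {k : Fin N // k ≠ j ∧ dist (x N j) (x N k) ≤ a * (1 + 1 / 400)}, k ≠ k' → (dist (x N k.1) (x N k'.1) ≤ a * (1 + 1 / 400) ↔ dist (e k).1 (e k').1 = 1))))} : ℝ) / N) Filter.atTop (nhds 0)) → 953 / 1000 ≤ a ∧ a ≤ 11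 / 10) → (∀ a : ℝ, 953 / 1000 ≤ a → a ≤ 11 / 10 → ∀ (N : ℕ) (x : Fin N → EuclideanSpace ℝ (Fin 3)) (i : Fin N), Function.Injective x → (∀ j : Fin N, dist (x i) (x j) ≤ 4 * a → (((∀ l : Fin N, l ≠ j → a * (1 - 1 / 400) ≤ dist (x j) (x l) ∧ (dist (x j) (x l) ≤ a * (1 + 1 / 400) ∨ 63 / 50 * a ≤ dist (x j) (x l))) ∧ Nat.card {l : Fin N // l ≠ j ∧ dist (x j) (x l) ≤ a * (1 + 1 / 400)} = 12) ∧ ((∃ e : {k : Fin N // k ≠ j ∧ dist (x j) (x k) ≤ a * (1 + 1 / 400)} ≃ {q : EuclideanSpace ℝ (Fin 3) // q ∈ Literature.Geometry.DiscreteGeometry.fccKissingPattern}, ∀ k k' : {k : Fin N // k ≠ j ∧ dist (x j) (x k) ≤ a * (1 + 1 / 400)}, k ≠ k' → (dist (x k.1) (x k'.1) ≤ a * (1 + 1 / 400) ↔ dist (e k).1 (e k').1 = 1)) ∨ (∃ e : {k : Fin N // k ≠ j ∧ dist (x j) (x k) ≤ a * (1 + 1 / 400)} ≃ {q : EuclideanSpace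 ℝ (Fin 3) // q ∈ Literature.Geometry.DiscreteGeometry.hcpKissingPattern}, ∀ k k' : {k : Fin N // k ≠ j ∧ dist (x j) (x k) ≤ a * (1 + 1 / 400)}, k ≠ k' → (dist (x k.1) (x k'.1) ≤ a * (1 + 1 / 400) ↔ dist (e k).1 (e k').1 = 1))))) → ∃ a : ℝ, 9 / 10 ≤ a ∧ a ≤ 11 / 10 ∧ (Literature.Geometry.DiscreteGeometry.ShellCloseTo (1 / 20) ((Finset.univ.filter fun j : Fin N => j ≠ i ∧ dist (x i) (x j) ≤ 6 / 5).image fun j => a⁻¹ • (x j - x i)) Literature.Geometry.DiscreteGeometry.fccKissingPattern ∨ Literature.Geometry.DiscreteGeometry.ShellCloseTo (1 / 20) ((Finset.univ.filter fun j : Fin N => j ≠ i ∧ dist (x i) (x j) ≤ 6 / 5).image fun j => a⁻¹ • (x j - x i)) Literature.Geometry.DiscreteGeometry.hcpKissingPattern)) → (Summit.AtomisticToContinuum.Crystallization.Theses.ReggeStarCoercivity.DefectFreeCrystallizes) → Summit.AtomisticToContinuum.Crystallization.Theses.BrittleRungDescent.LJBarlowRigidity := by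
  intro h1 h2 h3
  unfold Summit.AtomisticToContinuum.Crystallization.Theses.BrittleRungDescent.LJBarlowRigidity
  rintro ⟨a, ha, hH⟩
  obtain ⟨hlo, hhi⟩ := h1 a ha hH
  have hZ : Summit.AtomisticToContinuum.Crystallization.Theses.ReggeStarCoercivity.ZeroDefectDensity := by
    intro x hx
    exact tendsto_density_mono _ _ (fun N i hB => h2 a hlo hhi N (x N) i (hx N).1 hB) (hH x hx)
  exact crystallization_of_isCrystallizing (h3 hZ)

/-- **The crux from the three stubs** (the only `sorry`s in its cone are the three `stub_*`). -/
theorem LJBarlowRigidity_of_stubs : Summit.AtomisticToContinuum.Crystallization.Theses.BrittleRungDescent.LJBarlowRigidity :=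
  LJBarlowRigidity_of stub_scaleWindow13603 stub_shellCloseOfTrussGraph stub_defectFreeCrystallizes

/-! ## By-name readings -/

example : Summit.AtomisticToContinuum.Crystallization.Theses.BrittleRungDescent.LJBarlowRigidity ↔ ((∃ a : ℝ, 0 < a ∧ ∀ x : (N : ℕ) → (Fin N → EuclideanSpace ℝ (Fin 3)), (∀ N, Literature.MathematicalPhysics.StatisticalMechanics.IsGroundState Literature.MathematicalPhysics.StatisticalMechanics.lennardJones (x N)) → Filter.Tendsto (fun N : ℕ => (Nat.card {i : Fin N // ¬ ∀ j : Fin N, dist (x N i) (x N j) ≤ 4 * a → (((∀ l : Fin N, l ≠ j → a * (1 - 1 / 400) ≤ dist (x N j) (x N l) ∧ (dist (x N j) (x N l) ≤ a * (1 + 1 / 400) ∨ 63 / 50 * a ≤ dist (x N j) (x N l))) ∧ Nat.card {l : Fin N // l ≠ j ∧ dist (x N j) (x N l) ≤ a * (1 + 1 / 400)} = 12) ∧ ((∃ e : {k : Fin N // k ≠ j ∧ dist (x N j) (x N k) ≤ a * (1 + 1 / 400)} ≃ {q : EuclideanSpace ℝ (Fin 3) // q ∈ Literature.Geometry.DiscreteGeometry.fccKissingPattern},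 ∀ k k' : {k : Fin N // k ≠ j ∧ dist (x N j) (x N k) ≤ a * (1 + 1 / 400)}, k ≠ k' → (dist (x N k.1) (x N k'.1) ≤ a * (1 + 1 / 400) ↔ dist (e k).1 (e k').1 = 1)) ∨ (∃ e : {k : Fin N // k ≠ j ∧ dist (x N j) (x N k) ≤ a * (1 + 1 / 400)} ≃ {q : EuclideanSpace ℝ (Fin 3) // q ∈ Literature.Geometry.DiscreteGeometry.hcpKissingPattern}, ∀ k k' : {k : Fin N // k ≠ j ∧ dist (x N j) (x N k) ≤ a * (1 + 1 / 400)}, k ≠ k' → (dist (x N k.1) (x N k'.1) ≤ a * (1 + 1 / 400) ↔ dist (e k).1 (e k').1 = 1))))} : ℝ) / N) Filter.atTop (nhds 0)) → _root_.Crystallization) := Iff.rfl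

/-- B2's conclusion is VERBATIM the goodness predicate of `ZeroDefectDensity` / `DefectFreeCrystallizes`. -/
example : Summit.AtomisticToContinuum.Crystallization.Theses.ReggeStarCoercivity.ZeroDefectDensity ↔ (∀ x : (N : ℕ) → (Fin N → EuclideanSpace ℝ (Fin 3)), (∀ N, Literature.MathematicalPhysics.StatisticalMechanics.IsGroundState Literature.MathematicalPhysics.StatisticalMechanics.lennardJones (x N)) → Filter.Tendsto (fun N : ℕ => (Nat.card {i : Fin N // ¬ (∃ a : ℝ, 9 / 10 ≤ a ∧ a ≤ 11 / 10 ∧ (Literature.Geometry.DiscreteGeometry.ShellCloseTo (1 / 20) ((Finset.univ.filter fun j : Fin N => j ≠ i ∧ dist (x N i) (x N j) ≤ 6 / 5).image fun j => a⁻¹ • (x N j - x N i)) Literature.Geometry.DiscreteGeometry.fccKissingPattern ∨ Literature.Geometry.DiscreteGeometry.ShellCloseTo (1 / 20) ((Finset.univ.filter fun j : Fin N => j ≠ i ∧ dist (x N i) (x N j) ≤ 6 / 5).image fun j => a⁻¹ • (x N j - x N i)) Literature.Geometry.DiscreteGeometry.hcpKissingPattern))} : ℝ) / N) Filter.atTop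 (nhds 0)) := Iff.rfl

end Summit.AtomisticToContinuum.Crystallization.Cruxes.LJBarlowRigidity.DefectFreeTransfer
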